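import Summits.CriticalPhenomena.Ising3DConformalLimit.Theorems.HyperoctahedralRPExistsScaleCovariantLimitBlockDefs
import Literature.Probability.LatticeModels.HighDimPointwiseTriviality
import HarnessLib

/-!
# Block covariance algebra (line `monotone-blocking-port` of crux `ExistsScaleCovariantLimit`, stmt-CriticalPhenomena-1981; stub `stub_blockCovAlgebra`, S4a)

Lattice bookkeeping for the block covariance `C(L; k) = blockCov L k = Σ_{x,y ∈ cube L} ⟨σ_x σ_{y + L k}⟩_{β_c}`
of the critical nearest-neighbour Ising model on `ℤ³` (`V(L) = C(L; 0)` the block variance):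

1. `V(L) > 0` for `L ≥ 1` — every term is `≥ 0` (Griffiths, `criticalTwoPoint_nonneg'`) and the diagonal term
   `x = y = 0` is `⟨σ₀σ₀⟩ = 1` (`criticalTwoPoint_zero'`);
2. `L ↦ V(L)` is monotone — `cube L ⊆ cube L'` for `L ≤ L'` and all terms are `≥ 0`;
3. the SUB-CUBE DECOMPOSITION `V(jL) = Σ_{a,b ∈ cube j} C(L; b − a)` — the map `(a, x) ↦ L a + x` is a
   bijection `cube j × cube L → cube (jL)` (coordinatewise Euclidean division), and
   `(L b + y) − (L a + x) = (y − x) + L (b − a)`;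
4. the `n = 2` block moment is the ratio `R₂(L; (k₀, k₁)) = C(L; k₁ − k₀) / V(L)` — `V(L)^{2/2} = V(L)`, the
   pair correlator is `⟨σ_a σ_b⟩ = ⟨σ₀ σ_{b−a}⟩` (`criticalCorr_two_pair`), and a sum over `Fin 2`-tuples of
   `cube L` is a double sum.

No named facts. [folklore]
-/

noncomputable section

namespace Summit.CriticalPhenomena.Ising3DConformalLimit.Cruxes.ExistsScaleCovariantLimit.MonotoneBlockingPort

open Literature.Probability.LatticeModels Filter Set Finset
open scoped Topology BigOperators

/-! ## (1) positivity and (2) monotonicity of the block variance -/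

/-- `V(L) = Σ_{x,y ∈ cube L} ⟨σ_xσ_y⟩_{β_c} > 0` for `L ≥ 1`: all terms are nonnegative and the term
`x = y = 0` equals `⟨σ₀σ₀⟩ = 1`. [folklore] -/
theorem blockCov_zero_pos (L : ℕ) (hL : 1 ≤ L) : 0 < blockCov L 0 := by
  rw [blockCov_zero_eq]
  have h0 : (0 : Site 3) ∈ cube L := by
    rw [mem_cube]
    intro i
    simp only [Pi.zero_apply]
    exact ⟨le_rfl, by omega⟩
  refine Finset.sum_pos' (fun x _ => Finset.sum_nonneg fun y _ => criticalTwoPoint_nonneg' _) ⟨0, h0, ?_⟩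
  refine Finset.sum_pos' (fun y _ => criticalTwoPoint_nonneg' _) ⟨0, h0, ?_⟩
  rw [sub_zero, criticalTwoPoint_zero']
  exact one_pos

/-- `cube L ⊆ cube L'` for `L ≤ L'`. [folklore] -/
theorem cube_subset_cube {L L' : ℕ} (h : L ≤ L') : cube L ⊆ cube L' := by
  intro x hx
  rw [mem_cube] at hx ⊢
  intro i
  obtain ⟨h0, h1⟩ := hx i
  exact ⟨h0, by omega⟩

/-- `L ↦ V(L)` is monotone: `cube L ⊆ cube L'` and `⟨σ_xσ_y⟩_{β_c} ≥ 0`. [folklore] -/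
theorem blockCov_zero_monotone : Monotone fun L : ℕ => blockCov L 0 := by
  intro L L' hLL'
  show blockCov L 0 ≤ blockCov L' 0
  rw [blockCov_zero_eq, blockCov_zero_eq]
  have hsub : cube L ⊆ cube L' := cube_subset_cube hLL'
  calc ∑ x ∈ cube L, ∑ y ∈ cube L, criticalTwoPoint 3 (y - x)
      ≤ ∑ x ∈ cube L, ∑ y ∈ cube L', criticalTwoPoint 3 (y - x) :=
        Finset.sum_le_sum fun x _ =>
          Finset.sum_le_sum_of_subset_of_nonneg hsub fun y _ _ => criticalTwoPoint_nonneg' _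
    _ ≤ ∑ x ∈ cube L', ∑ y ∈ cube L', criticalTwoPoint 3 (y - x) :=
        Finset.sum_le_sum_of_subset_of_nonneg hsub fun x _ _ =>
          Finset.sum_nonneg fun y _ => criticalTwoPoint_nonneg' _

/-! ## (3) the sub-cube decomposition -/

/-- Change of variables `x = L a + x'`, `(a, x') ∈ cube j × cube L`, in a sum over `cube (jL)` (`L ≥ 1`): the
map `(a, x') ↦ L a + x'` is a bijection onto `cube (jL)` with inverse the coordinatewise Euclidean division
`x ↦ (x / L, x % L)`. [folklore] -/
theorem sum_cube_mul {L : ℕ} (hL : 1 ≤ L) (j : ℕ) (f : Site 3 → ℝ) :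
    ∑ x ∈ cube (j * L), f x = ∑ a ∈ cube j, ∑ x ∈ cube L, f ((L : ℤ) • a + x) := by
  have hL' : (0 : ℤ) < L := by omega
  have hL0 : (0 : ℤ) ≤ L := hL'.le
  have hLne : (L : ℤ) ≠ 0 := hL'.ne'
  rw [← Finset.sum_product (cube j) (cube L) (fun p => f ((L : ℤ) • p.1 + p.2))]
  symm
  refine Finset.sum_nbij' (fun p : Site 3 × Site 3 => (L : ℤ) • p.1 + p.2)
    (fun x => (fun i => x i / (L : ℤ), fun i => x i % (L : ℤ))) ?_ ?_ ?_ ?_ (fun _ _ => rfl)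
  · -- `(a, x') ↦ L a + x'` maps `cube j × cube L` into `cube (jL)`
    intro p hp
    rw [Finset.mem_product, mem_cube, mem_cube] at hp
    refine mem_cube.2 fun i => ?_
    obtain ⟨ha0, haj⟩ := hp.1 i
    obtain ⟨hx0, hxL⟩ := hp.2 i
    show 0 ≤ ((L : ℤ) • p.1 + p.2) i ∧ ((L : ℤ) • p.1 + p.2) i < ((j * L : ℕ) : ℤ)
    simp only [Pi.add_apply, Pi.smul_apply, smul_eq_mul, Nat.cast_mul]
    have h1 := mul_le_mul_of_nonneg_left (Int.add_one_le_iff.mpr haj) hL0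
    constructor <;> nlinarith
  · -- Euclidean division maps `cube (jL)` into `cube j × cube L`
    intro x hx
    rw [mem_cube] at hx
    refine Finset.mem_product.2 ⟨mem_cube.2 fun i => ⟨Int.ediv_nonneg (hx i).1 hL0, ?_⟩,
      mem_cube.2 fun i => ⟨Int.emod_nonneg _ hLne, Int.emod_lt_of_pos _ hL'⟩⟩
    show x i / (L : ℤ) < (j : ℤ)
    rw [Int.ediv_lt_iff_lt_mul hL']
    have h2 := (hx i).2
    push_cast at h2
    exact h2
  · -- left inverse: `(L a + x') / L = a`, `(L a + x') % L = x'`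
    intro p hp
    rw [Finset.mem_product] at hp
    have hx := mem_cube.1 hp.2
    have key : ∀ i, ((L : ℤ) • p.1 + p.2) i / (L : ℤ) = p.1 i ∧ ((L : ℤ) • p.1 + p.2) i % (L : ℤ) = p.2 i :=
      fun i => (Int.ediv_emod_unique hL').2
        ⟨by simp only [Pi.add_apply, Pi.smul_apply, smul_eq_mul]; ring, (hx i).1, (hx i).2⟩
    exact Prod.ext (funext fun i => (key i).1) (funext fun i => (key i).2)
  · -- right inverse: `L (x / L) + x % L = x`
    intro x _
    funext i
    show (L : ℤ) * (x i / (L : ℤ)) + x i % (L : ℤ) = x i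
    exact Int.mul_ediv_add_emod (x i) L

/-- THE SUB-CUBE DECOMPOSITION `V(jL) = Σ_{a,b ∈ cube j} C(L; b − a)`: split both sites of
`V(jL) = Σ_{x,y ∈ cube (jL)} ⟨σ_xσ_y⟩` as `x = L a + x'`, `y = L b + y'` and use
`(L b + y') − (L a + x') = (y' − x') + L (b − a)`; at `L = 0` both sides vanish. [folklore] -/
theorem blockCov_mul_zero_eq (j L : ℕ) :
    blockCov (j * L) 0 = ∑ a ∈ cube j, ∑ b ∈ cube j, blockCov L (b - a) := by
  rcases Nat.eq_zero_or_pos L with rfl | hL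
  · simp [blockCov, cube_zero]
  · rw [blockCov_zero_eq, sum_cube_mul hL]
    have inner : ∀ a x : Site 3, ∑ y ∈ cube (j * L), criticalTwoPoint 3 (y - ((L : ℤ) • a + x)) =
        ∑ b ∈ cube j, ∑ y ∈ cube L, criticalTwoPoint 3 (y - x + (L : ℤ) • (b - a)) := by
      intro a x
      rw [sum_cube_mul hL]
      refine Finset.sum_congr rfl fun b _ => Finset.sum_congr rfl fun y _ => ?_
      congr 1
      rw [smul_sub]
      abel
    simp_rw [inner]
    refine Finset.sum_congr rfl fun a _ => ?_
    simp only [blockCov]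
    exact Finset.sum_comm

/-! ## (4) the `n = 2` block moment is the covariance ratio -/

/-- A sum over `Fin 2`-tuples of `s` is a double sum over `s`. [folklore] -/
theorem sum_piFinset_two {α M : Type*} [AddCommMonoid M] (s : Finset α) (g : α → α → M) :
    ∑ u ∈ Fintype.piFinset (fun _ : Fin 2 => s), g (u 0) (u 1) = ∑ x ∈ s, ∑ y ∈ s, g x y := by
  rw [← Finset.sum_product']
  refine Finset.sum_nbij' (fun u => (u 0, u 1)) (fun p => ![p.1, p.2]) ?_ ?_ ?_ ?_ (fun _ _ => rfl)
  · intro u hu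
    rw [Fintype.mem_piFinset] at hu
    exact Finset.mem_product.2 ⟨hu 0, hu 1⟩
  · intro p hp
    rw [Finset.mem_product] at hp
    rw [Fintype.mem_piFinset]
    intro i
    fin_cases i
    · simpa using hp.1
    · simpa using hp.2
  · intro u _
    funext i
    fin_cases i <;> rfl
  · intro p _
    rfl

/-- `R₂(L; (k₀, k₁)) = C(L; k₁ − k₀) / V(L)`: the exponent `2/2 = 1`, `⟨σ_{x₀+Lk₀} σ_{x₁+Lk₁}⟩ =
⟨σ₀ σ_{x₁−x₀+L(k₁−k₀)}⟩` (`criticalCorr_two_pair`), and the tuple sum is a double sum. [folklore] -/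
theorem critBlockMoment_two (L : ℕ) (k : Fin 2 → Site 3) :
    critBlockMoment 2 L k = blockCov L (k 1 - k 0) / blockCov L 0 := by
  unfold critBlockMoment
  have hpow : blockCov L 0 ^ (((2 : ℕ) : ℝ) / 2) = blockCov L 0 := by
    rw [show ((2 : ℕ) : ℝ) / 2 = 1 by norm_num, Real.rpow_one]
  rw [hpow]
  congr 1
  have hsum : ∀ x : Fin 2 → Site 3, criticalCorr 3 2 (fun i => x i + (L : ℤ) • k i) =
      criticalTwoPoint 3 (x 1 - x 0 + (L : ℤ) • (k 1 - k 0)) := by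
    intro x
    have hx : (fun i => x i + (L : ℤ) • k i) = ![x 0 + (L : ℤ) • k 0, x 1 + (L : ℤ) • k 1] := by
      funext i
      fin_cases i <;> rfl
    rw [hx, criticalCorr_two_pair]
    congr 1
    rw [smul_sub]
    abel
  simp_rw [hsum]
  rw [sum_piFinset_two (cube L) (fun a b => criticalTwoPoint 3 (b - a + (L : ℤ) • (k 1 - k 0)))]
  rfl

/-! ## The stub -/

/-- **S4a — block covariance algebra.** (1) `V(L) > 0` for `L ≥ 1`; (2) `L ↦ V(L)` is monotone; (3) the
sub-cube decomposition `V(jL) = Σ_{a,b ∈ cube j} C(L; b − a)`; (4) `R₂(L; (k₀,k₁)) = C(L; k₁ − k₀)/V(L)`.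
[folklore] -/
theorem stub_blockCovAlgebra : Sig.stub_blockCovAlgebra :=
  ⟨blockCov_zero_pos, blockCov_zero_monotone, blockCov_mul_zero_eq, critBlockMoment_two⟩

end Summit.CriticalPhenomena.Ising3DConformalLimit.Cruxes.ExistsScaleCovariantLimit.MonotoneBlockingPort

end
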